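import Mathlib.Probability.ProbabilityMassFunction.Constructions
import Mathlib.MeasureTheory.Integral.Lebesgue.Countable
import Mathlib.MeasureTheory.Measure.Typeclasses.Probability
import HarnessLib

/-!
# Mixing a `PMF`-valued kernel over a probability measure

Topic `Probability/Distributions`. Generic infrastructure (no named fact): a randomised procedure that
first draws a CONTINUOUS parameter `ω ∼ ν` (a probability measure on any measurable space) and then
outputs a DISCRETE value from a probability mass function `κ ω` defines a probability mass function
`pmfMixture ν κ` on the outputs (declared in `Literature.Probability.Distributions`, NOT in Mathlib's `PMF`
namespace), `Pr[b] = ∫ κ ω b dν(ω)`, provided each `ω ↦ κ ω b` is measurable. This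
is the shape of every reduction of BLPRS 2013 §4 that uses continuous coins (the Gaussian `f` and the
uniform jitter of Lemma 4.7) but talks to discrete oracles (pqc.S21,
`Literature.Computability.Cryptography.blprs_gapSVP_sqrt_dim_to_lwe_classical`); the rounding laws of
`GaussianRoundingLaw(Mixture).lean` are the special case `κ ω = D_{L,s,ω}`.

## Results

* `pmfMixtureMass`, `tsum_pmfMixtureMass` (`= 1`, Tonelli), **`pmfMixture ν κ hκ : PMF β`**,
  `pmfMixture_apply`;
* `toOuterMeasure_pmfMixture_apply` — events: `Pr_{pmfMixture}[S] = ∫⁻ Pr_{κ ω}[S] dν`;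
* `measurable_pmf_map_apply_of`, `measurable_pmf_bind_apply_of` (measurability is preserved by
  post-processing) and **`pmfMixture_map`**, **`pmfMixture_bind`** — post-processing commutes with
  mixing; `pmfMixture_const` — a constant kernel mixes to itself.

[folklore]
-/

noncomputable section

open MeasureTheory
open scoped ENNReal

namespace Literature.Probability.Distributions

variable {Ω β γ : Type*} [MeasurableSpace Ω] [Countable β] [Countable γ]

/-- The mass at `b` of the pmfMixture: `∫⁻ κ ω b dν`. [folklore] -/
def pmfMixtureMass (ν : Measure Ω) (κ : Ω → PMF β) (b : β) : ℝ≥0∞ := ∫⁻ ω, κ ω b ∂ν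

/-- The masses of the pmfMixture sum to `1` (Tonelli and `∑_b κ ω b = 1`). [folklore] -/
theorem tsum_pmfMixtureMass (ν : Measure Ω) [IsProbabilityMeasure ν] (κ : Ω → PMF β)
    (hκ : ∀ b, Measurable fun ω => κ ω b) : ∑' b, pmfMixtureMass ν κ b = 1 := by
  unfold pmfMixtureMass
  rw [← lintegral_tsum fun b => (hκ b).aemeasurable]
  simp_rw [PMF.tsum_coe]
  rw [lintegral_const, one_mul, measure_univ]

/-- **The pmfMixture of a measurable `PMF`-valued kernel over a probability measure.** [folklore] -/
def pmfMixture (ν : Measure Ω) [IsProbabilityMeasure ν] (κ : Ω → PMF β) (hκ : ∀ b, Measurable fun ω => κ ω b) :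
    PMF β :=
  ⟨pmfMixtureMass ν κ, ENNReal.summable.hasSum_iff.2 (tsum_pmfMixtureMass ν κ hκ)⟩

/-- Unfolding. [folklore] -/
@[simp] theorem pmfMixture_apply (ν : Measure Ω) [IsProbabilityMeasure ν] (κ : Ω → PMF β)
    (hκ : ∀ b, Measurable fun ω => κ ω b) (b : β) : pmfMixture ν κ hκ b = ∫⁻ ω, κ ω b ∂ν := rfl

/-- **Events under the pmfMixture**: `Pr[S] = ∫⁻ (κ ω)(S) dν`. [folklore] -/
theorem toOuterMeasure_pmfMixture_apply (ν : Measure Ω) [IsProbabilityMeasure ν] (κ : Ω → PMF β)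
    (hκ : ∀ b, Measurable fun ω => κ ω b) (S : Set β) :
    (pmfMixture ν κ hκ).toOuterMeasure S = ∫⁻ ω, (κ ω).toOuterMeasure S ∂ν := by
  classical
  have hmeas : ∀ b, Measurable fun ω => S.indicator (κ ω) b := by
    intro b
    by_cases hb : b ∈ S
    · simp only [Set.indicator_of_mem hb]; exact hκ b
    · simp only [Set.indicator_of_notMem hb]; exact measurable_const
  simp_rw [PMF.toOuterMeasure_apply]
  rw [lintegral_tsum fun b => (hmeas b).aemeasurable]
  refine tsum_congr fun b => ?_
  by_cases hb : b ∈ S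
  · simp only [Set.indicator_of_mem hb, pmfMixture_apply]
  · simp only [Set.indicator_of_notMem hb, lintegral_const, zero_mul]

omit [Countable γ] in
/-- Measurability is preserved by mapping the kernel. [folklore] -/
theorem measurable_pmf_map_apply_of {κ : Ω → PMF β} (hκ : ∀ b, Measurable fun ω => κ ω b) (g : β → γ) (c : γ) :
    Measurable fun ω => (κ ω).map g c := by
  classical
  have h : (fun ω => (κ ω).map g c) = fun ω => ∑' b, if c = g b then κ ω b else 0 := by
    funext ω; rw [PMF.map_apply]
  rw [h]
  refine Measurable.tsum fun b => ?_
  by_cases hb : c = g b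
  · simp only [if_pos hb]; exact hκ b
  · simp only [if_neg hb]; exact measurable_const

omit [Countable γ] in
/-- Measurability is preserved by binding the kernel with a fixed kernel. [folklore] -/
theorem measurable_pmf_bind_apply_of {κ : Ω → PMF β} (hκ : ∀ b, Measurable fun ω => κ ω b) (K : β → PMF γ) (c : γ) :
    Measurable fun ω => (κ ω).bind K c := by
  have h : (fun ω => (κ ω).bind K c) = fun ω => ∑' b, κ ω b * K b c := by
    funext ω; rw [PMF.bind_apply]
  rw [h]
  exact Measurable.tsum fun b => (hκ b).mul_const _

/-- **Mapping commutes with mixing**: `(pmfMixture ν κ).map g = pmfMixture ν (ω ↦ (κ ω).map g)`. [folklore] -/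
theorem pmfMixture_map (ν : Measure Ω) [IsProbabilityMeasure ν] (κ : Ω → PMF β)
    (hκ : ∀ b, Measurable fun ω => κ ω b) (g : β → γ) :
    (pmfMixture ν κ hκ).map g = pmfMixture ν (fun ω => (κ ω).map g) (measurable_pmf_map_apply_of hκ g) := by
  classical
  refine PMF.ext fun c => ?_
  have hmeas : ∀ b, Measurable fun ω => if c = g b then κ ω b else 0 := by
    intro b
    by_cases hb : c = g b
    · simp only [if_pos hb]; exact hκ b
    · simp only [if_neg hb]; exact measurable_const
  rw [PMF.map_apply, pmfMixture_apply]
  simp_rw [PMF.map_apply, pmfMixture_apply]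
  rw [lintegral_tsum fun b => (hmeas b).aemeasurable]
  refine tsum_congr fun b => ?_
  by_cases hb : c = g b
  · simp only [if_pos hb]
  · simp only [if_neg hb, lintegral_const, zero_mul]

/-- **Binding commutes with mixing**: `(pmfMixture ν κ).bind K = pmfMixture ν (ω ↦ (κ ω).bind K)`. [folklore] -/
theorem pmfMixture_bind (ν : Measure Ω) [IsProbabilityMeasure ν] (κ : Ω → PMF β)
    (hκ : ∀ b, Measurable fun ω => κ ω b) (K : β → PMF γ) :
    (pmfMixture ν κ hκ).bind K = pmfMixture ν (fun ω => (κ ω).bind K) (measurable_pmf_bind_apply_of hκ K) := by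
  refine PMF.ext fun c => ?_
  rw [PMF.bind_apply, pmfMixture_apply]
  simp_rw [PMF.bind_apply, pmfMixture_apply]
  rw [lintegral_tsum fun b => ((hκ b).mul_const _).aemeasurable]
  refine tsum_congr fun b => ?_
  rw [lintegral_mul_const _ (hκ b)]

/-- A constant kernel mixes to itself. [folklore] -/
theorem pmfMixture_const (ν : Measure Ω) [IsProbabilityMeasure ν] (p : PMF β) :
    pmfMixture ν (fun _ => p) (fun _ => measurable_const) = p := by
  refine PMF.ext fun b => ?_
  rw [pmfMixture_apply, lintegral_const, measure_univ, mul_one]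

end Literature.Probability.Distributions

end
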